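import Mathlib
import Summits.Ventures.PercRepro2.Defs
import Summits.Ventures.PercRepro2.Graph
import Summits.Ventures.PercRepro2.Events
import Summits.Ventures.PercRepro2.Exploration

/-!
# The star of `a₃` glues its open neighbours (blind cell PercRepro2, night-1 g8)

Close every edge at `a₃`: `ω₁ = restrict (touches ends {a₃})ᶜ ω`.  A connection in `ω` between two
vertices other than `a₃` either avoids `a₃` (a connection of `ω₁`) or passes through `a₃`, entering
and leaving by open edges of the star: it joins `x` to some open neighbour `m` of `a₃` and some open
neighbour `m'` of `a₃` to `y` in `ω₁` (`conn_iff_glue`).  The cluster of `a₃` is `{a₃}` together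
with the `ω₁`-clusters of its open neighbours (`conn_a3_iff_glue`).  No hypothesis on the graph:
this is the general form of the pocket lemma `PocketConn.conn_iff_conn_restrict` for the
one-vertex pocket `{a₃}` without the event `Q`.  It is the graph-theoretic core of every
«`a₃` adjacent only to marks» class (NIGHT1-G8.md §2).
-/

namespace Summit.Ventures.PercRepro2

namespace StarGlue

variable {V : Type*} {E : Type*}

/-- The configuration with the star of `a₃` closed. -/
abbrev closeStar (ends : E → Sym2 V) (a₃ : V) [DecidablePred (· ∈ (touches ends {a₃})ᶜ)]
    (ω : Config E) : Config E :=
  restrict (touches ends {a₃})ᶜ ω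

/-- An edge not at `a₃` is open in `closeStar` iff it is open in `ω`. -/
lemma closeStar_apply_of_not_mem {ends : E → Sym2 V} {a₃ : V}
    [DecidablePred (· ∈ (touches ends {a₃})ᶜ)] {ω : Config E} {e : E} (he : a₃ ∉ ends e) :
    closeStar ends a₃ ω e = ω e := by
  apply restrict_apply_of_mem
  rintro ⟨x, hx, y, hxy⟩
  rw [Set.mem_singleton_iff] at hx
  subst hx
  exact he (by rw [hxy]; exact Sym2.mem_mk_left _ _)

/-- An edge at `a₃` is closed in `closeStar`. -/
lemma closeStar_apply_of_mem {ends : E → Sym2 V} {a₃ : V}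
    [DecidablePred (· ∈ (touches ends {a₃})ᶜ)] {ω : Config E} {e : E} (he : a₃ ∈ ends e) :
    closeStar ends a₃ ω e = false := by
  apply restrict_apply_of_notMem
  intro h
  apply h
  obtain ⟨y, hy⟩ := Sym2.mem_iff_exists.1 he
  exact ⟨a₃, Set.mem_singleton _, y, hy⟩

/-- `a₃` is isolated in `closeStar`. -/
lemma not_conn_closeStar {ends : E → Sym2 V} {a₃ : V}
    [DecidablePred (· ∈ (touches ends {a₃})ᶜ)] {ω : Config E} {x : V} (hx : x ≠ a₃) :
    ¬ Conn ends (closeStar ends a₃ ω) x a₃ := by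
  intro h
  have key := mem_of_conn_of_closed (ends := ends) (ω := closeStar ends a₃ ω) (S := {w | w ≠ a₃})
    (fun w hw u hwu => ?_) hx h
  · exact key rfl
  · obtain ⟨_, e', he', hends'⟩ := openGraph_adj.1 hwu
    intro hu
    have : a₃ ∈ ends e' := by rw [hends', hu]; exact Sym2.mem_mk_right _ _
    rw [closeStar_apply_of_mem this] at he'
    exact Bool.false_ne_true he'

/-- An open edge of `ω` not at `a₃` is open in `closeStar`. -/
lemma openAdj_closeStar {ends : E → Sym2 V} {a₃ : V}
    [DecidablePred (· ∈ (touches ends {a₃})ᶜ)] {ω : Config E} {e : E} {x y : V}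
    (he : ω e = true) (hends : ends e = s(x, y)) (hx : x ≠ a₃) (hy : y ≠ a₃) :
    OpenAdj ends (closeStar ends a₃ ω) x y := by
  refine ⟨e, ?_, hends⟩
  rw [closeStar_apply_of_not_mem, he]
  rw [hends, Sym2.mem_iff]
  rintro (h | h)
  · exact hx h.symm
  · exact hy h.symm

/-- **The glue lemma.**  For `x, y ≠ a₃`: `x ↔ y` in `ω` iff `x ↔ y` with the star closed, or `x`
reaches an open neighbour of `a₃` and an open neighbour of `a₃` reaches `y` (with the star closed). -/
theorem conn_iff_glue {ends : E → Sym2 V} {a₃ : V}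
    [DecidablePred (· ∈ (touches ends {a₃})ᶜ)] {ω : Config E} {x y : V} (hx : x ≠ a₃)
    (hy : y ≠ a₃) :
    Conn ends ω x y ↔ Conn ends (closeStar ends a₃ ω) x y ∨
      ((∃ m, OpenAdj ends ω a₃ m ∧ Conn ends (closeStar ends a₃ ω) x m) ∧
        (∃ m', OpenAdj ends ω a₃ m' ∧ Conn ends (closeStar ends a₃ ω) m' y)) := by
  classical
  set ω₁ := closeStar ends a₃ ω with hω₁
  have hle : ω₁ ≤ ω := restrict_le _ ω
  constructor
  · intro h
    -- the closed set
    let R : Prop := ∃ m, OpenAdj ends ω a₃ m ∧ Conn ends ω₁ x m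
    have key : y ∈ {z | (z ≠ a₃ ∧ (Conn ends ω₁ x z ∨
        (R ∧ ∃ m', OpenAdj ends ω a₃ m' ∧ Conn ends ω₁ m' z))) ∨ (z = a₃ ∧ R)} := by
      refine mem_of_conn_of_closed (ends := ends) (ω := ω) ?_ (Or.inl ⟨hx, Or.inl (conn_refl _ _ _)⟩) h
      rintro z hz w hzw
      obtain ⟨hne, e, he, hends⟩ := openGraph_adj.1 hzw
      simp only [Set.mem_setOf_eq] at hz ⊢
      by_cases hw3 : w = a₃
      · -- arriving at `a₃` from `z ≠ a₃`
        refine Or.inr ⟨hw3, ?_⟩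
        have hz3 : z ≠ a₃ := fun h => hne (h.trans hw3.symm)
        rcases hz with ⟨_, hzc | ⟨hR, _⟩⟩ | ⟨hz3', _⟩
        · exact ⟨z, ⟨e, he, by rw [hends, hw3, Sym2.eq_swap]⟩, hzc⟩
        · exact hR
        · exact absurd hz3' hz3
      · by_cases hz3 : z = a₃
        · -- leaving `a₃`
          rcases hz with ⟨h', _⟩ | ⟨_, hR⟩
          · exact absurd hz3 h'
          · exact Or.inl ⟨hw3, Or.inr ⟨hR, w, ⟨e, he, by rw [hends, hz3]⟩, conn_refl _ _ _⟩⟩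
        · -- an edge off the star
          have hadj : OpenAdj ends ω₁ z w := openAdj_closeStar he hends hz3 hw3
          rcases hz with ⟨_, hzc | ⟨hR, m', hm', hc⟩⟩ | ⟨hz3', _⟩
          · exact Or.inl ⟨hw3, Or.inl (conn_trans hzc (conn_of_openAdj hadj))⟩
          · exact Or.inl ⟨hw3, Or.inr ⟨hR, m', hm', conn_trans hc (conn_of_openAdj hadj)⟩⟩
          · exact absurd hz3' hz3
    simp only [Set.mem_setOf_eq] at key
    rcases key with ⟨_, hc | ⟨hR, hR'⟩⟩ | ⟨hy3, _⟩
    · exact Or.inl hc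
    · exact Or.inr ⟨hR, hR'⟩
    · exact absurd hy3 hy
  · rintro (h | ⟨⟨m, hm, hxm⟩, ⟨m', hm', hmy⟩⟩)
    · exact conn_mono hle h
    · exact conn_trans (conn_mono hle hxm) (conn_trans (conn_symm (conn_of_openAdj hm))
        (conn_trans (conn_of_openAdj hm') (conn_mono hle hmy)))

/-- **The cluster of `a₃`.**  For `y ≠ a₃`: `a₃ ↔ y` in `ω` iff an open neighbour of `a₃` reaches
`y` with the star closed. -/
theorem conn_a3_iff_glue {ends : E → Sym2 V} {a₃ : V}
    [DecidablePred (· ∈ (touches ends {a₃})ᶜ)] {ω : Config E} {y : V} (hy : y ≠ a₃) :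
    Conn ends ω a₃ y ↔ ∃ m', OpenAdj ends ω a₃ m' ∧ Conn ends (closeStar ends a₃ ω) m' y := by
  classical
  set ω₁ := closeStar ends a₃ ω with hω₁
  have hle : ω₁ ≤ ω := restrict_le _ ω
  constructor
  · intro h
    have key : y ∈ {z | z = a₃ ∨ (z ≠ a₃ ∧ ∃ m', OpenAdj ends ω a₃ m' ∧ Conn ends ω₁ m' z)} := by
      refine mem_of_conn_of_closed (ends := ends) (ω := ω) ?_ (Or.inl rfl) h
      rintro z hz w hzw
      obtain ⟨hne, e, he, hends⟩ := openGraph_adj.1 hzw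
      simp only [Set.mem_setOf_eq] at hz ⊢
      by_cases hw3 : w = a₃
      · exact Or.inl hw3
      · rcases hz with hz3 | ⟨hz3, m', hm', hc⟩
        · exact Or.inr ⟨hw3, w, ⟨e, he, by rw [hends, hz3]⟩, conn_refl _ _ _⟩
        · have hadj : OpenAdj ends ω₁ z w := openAdj_closeStar he hends hz3 hw3
          exact Or.inr ⟨hw3, m', hm', conn_trans hc (conn_of_openAdj hadj)⟩
    simp only [Set.mem_setOf_eq] at key
    rcases key with hy3 | ⟨_, hm⟩
    · exact absurd hy3 hy
    · exact hm
  · rintro ⟨m', hm', hmy⟩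
    exact conn_trans (conn_of_openAdj hm') (conn_mono hle hmy)

end StarGlue

end Summit.Ventures.PercRepro2
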